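import Summits.RiemannHypothesis.RiemannHypothesis.Theorems.SpectralTraceSpectralThesisStubDensityAux
import Summits.RiemannHypothesis.RiemannHypothesis.Theorems.SpectralTraceSpectralThesisStubFixedPoint
import Literature.NumberTheory.LFunctions.RiemannSiegelFacts
import Literature.NumberTheory.LFunctions.RiemannSiegelThetaBounds
import HarnessLib

/-!
# Crux `SpectralThesis` (stmt-RiemannHypothesis-0187), line `Sketch` — stub `stub_density`, scale `A`

The density at scale `A` for `stub_density` (`Theorems/SpectralTraceSpectralThesisStubDensity.lean`):
with `ℓ(s) = log(1+s²)/(4π)` (derivatives `ℓ', ℓ''` bounded by `1`), a `C²` kernel `K` with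
`K, K', K'' = O(1/(1+t²))`, `∫ K = 1`, a bounded continuous `b` and the log-smoothing constant `M`,
`ν(t) = ∫ K(u) ℓ(t − u/A) du + A ∫ K(A(t−s)) b(s) ds` is `C²`,
`|ν(t) − log(1/A)/2π − log(1+(At)²)/4π| ≤ M/4π + CBπ` (from
`log(1 + (t−u/A)²) = 2 log(1/A) + log(A² + (At−u)²)` and `∫ K = 1`), `|ν'|, |ν''| ≤ Cπ(1+B)`
uniformly in `0 < A ≤ 1` (`scale_density`; integrability of the kernels from the sibling
`FixedPoint.integrable_of_decay`). Also: `θ'/π − ℓ` is bounded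
(`thetaDeriv_sub_log_bounded`, from `abs_riemannSiegelThetaDeriv_sub_log_le`, evenness and
continuity of `θ' = riemannSiegelThetaDeriv`).
-/

noncomputable section

set_option linter.dupNamespace false
set_option autoImplicit false

open Complex Set MeasureTheory Filter
open scoped Real ContDiff Topology

namespace Summit.RiemannHypothesis.RiemannHypothesis.Theorems.SpectralThesis.Sketch

open Literature.NumberTheory.LFunctions

namespace Density

/-! ### The explicit smooth part `ℓ(s) = log(1+s²)/(4π)` -/

/-- `ℓ' = 2s/(1+s²)/(4π)`. [folklore] -/
theorem hasDerivAt_ell (s : ℝ) :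
    HasDerivAt (fun s : ℝ => Real.log (1 + s ^ 2) / (4 * π)) (2 * s / (1 + s ^ 2) / (4 * π)) s := by
  have h1 : HasDerivAt (fun s : ℝ => 1 + s ^ 2) (2 * s) s := by
    simpa using (hasDerivAt_pow 2 s).const_add 1
  exact (h1.log (by positivity)).div_const (4 * π)

/-- `ℓ'' = (2(1+s²) − 4s²)/(1+s²)²/(4π)`. [folklore] -/
theorem hasDerivAt_ell₁ (s : ℝ) :
    HasDerivAt (fun s : ℝ => 2 * s / (1 + s ^ 2) / (4 * π))
      ((2 * (1 + s ^ 2) - 2 * s * (2 * s)) / (1 + s ^ 2) ^ 2 / (4 * π)) s := by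
  have h1 : HasDerivAt (fun s : ℝ => 1 + s ^ 2) (2 * s) s := by
    simpa using (hasDerivAt_pow 2 s).const_add 1
  have h2 : HasDerivAt (fun s : ℝ => 2 * s) 2 s := by simpa using (hasDerivAt_id s).const_mul 2
  exact (h2.div h1 (by positivity)).div_const (4 * π)

/-- `ℓ''` is continuous. [folklore] -/
theorem continuous_ell₂ :
    Continuous fun s : ℝ => (2 * (1 + s ^ 2) - 2 * s * (2 * s)) / (1 + s ^ 2) ^ 2 / (4 * π) := by
  have h1 : Continuous fun s : ℝ => 1 + s ^ 2 := by fun_prop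
  have hne : ∀ s : ℝ, (1 + s ^ 2) ^ 2 ≠ 0 := fun s => by positivity
  exact ((by fun_prop : Continuous fun s : ℝ => 2 * (1 + s ^ 2) - 2 * s * (2 * s)).div
    (h1.pow 2) hne).div_const _

/-- `|ℓ'| ≤ 1`. [folklore] -/
theorem abs_ell₁_le (s : ℝ) : |2 * s / (1 + s ^ 2) / (4 * π)| ≤ 1 := by
  have h4π : (1 : ℝ) ≤ 4 * π := by linarith [Real.pi_gt_three]
  have h4πpos : (0 : ℝ) < 4 * π := by positivity
  have hpos : (0 : ℝ) < 1 + s ^ 2 := by positivity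
  have h1 : |2 * s / (1 + s ^ 2)| ≤ 1 := by
    rw [abs_div, abs_of_pos hpos, div_le_one hpos, abs_le]
    constructor <;> nlinarith [sq_nonneg (s + 1), sq_nonneg (s - 1)]
  rw [abs_div, abs_of_pos h4πpos, div_le_one h4πpos]
  exact h1.trans h4π

/-- `|ℓ''| ≤ 1`. [folklore] -/
theorem abs_ell₂_le (s : ℝ) : |(2 * (1 + s ^ 2) - 2 * s * (2 * s)) / (1 + s ^ 2) ^ 2 / (4 * π)| ≤ 1 := by
  have h4πpos : (0 : ℝ) < 4 * π := by positivity
  have hpos : (0 : ℝ) < (1 + s ^ 2) ^ 2 := by positivity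
  have h1 : |(2 * (1 + s ^ 2) - 2 * s * (2 * s)) / (1 + s ^ 2) ^ 2| ≤ 2 := by
    rw [abs_div, abs_of_pos hpos, div_le_iff₀ hpos, abs_le]
    constructor <;> nlinarith [sq_nonneg s, sq_nonneg (s ^ 2)]
  rw [abs_div, abs_of_pos h4πpos, div_le_one h4πpos]
  exact h1.trans (by linarith [Real.pi_gt_three])

/-- `0 ≤ ℓ(s) ≤ log(1+s²)` (as `4π ≥ 1`). [folklore] -/
theorem abs_ell_le (s : ℝ) : |Real.log (1 + s ^ 2) / (4 * π)| ≤ Real.log (1 + s ^ 2) := by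
  have h4π : (1 : ℝ) ≤ 4 * π := by linarith [Real.pi_gt_three]
  have h0 : 0 ≤ Real.log (1 + s ^ 2) := Real.log_nonneg (by nlinarith)
  rw [abs_div, abs_of_nonneg h0, abs_of_pos (by positivity : (0 : ℝ) < 4 * π)]
  exact div_le_self h0 h4π

/-! ### The bounded part of `θ'/π` -/

/-- `θ'/π − log(1+s²)/(4π)` is bounded on `ℝ` (`θ' = riemannSiegelThetaDeriv`; first-order
Stirling `|θ'(u) − ½ log(u/2π)| ≤ 2/u` for `u ≥ 1`, evenness, continuity on `[-1, 1]`).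
[folklore] -/
theorem thetaDeriv_sub_log_bounded :
    ∃ B₀ : ℝ, ∀ s : ℝ,
      |riemannSiegelThetaDeriv s / π - Real.log (1 + s ^ 2) / (4 * π)| ≤ B₀ := by
  obtain ⟨M₀, hM₀⟩ := (isCompact_Icc (a := (-1 : ℝ)) (b := 1)).exists_bound_of_continuousOn
    (continuous_riemannSiegelThetaDeriv_holds.continuousOn (s := Icc (-1 : ℝ) 1))
  have hM₀n : 0 ≤ M₀ := (norm_nonneg _).trans (hM₀ 0 ⟨by norm_num, by norm_num⟩)
  have hπ3 : 3 < π := Real.pi_gt_three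
  have hlog2π : 0 ≤ Real.log (2 * π) := Real.log_nonneg (by linarith)
  have hlog2 : 0 ≤ Real.log 2 := Real.log_nonneg one_le_two
  have hlog2' : Real.log 2 < 1 := by have := Real.log_two_lt_d9; linarith
  refine ⟨M₀ + 1 + (2 + Real.log (2 * π) + Real.log 2), fun s => ?_⟩
  have hred : |riemannSiegelThetaDeriv s / π - Real.log (1 + s ^ 2) / (4 * π)| ≤
      |riemannSiegelThetaDeriv s - Real.log (1 + s ^ 2) / 4| := by
    have e : riemannSiegelThetaDeriv s / π - Real.log (1 + s ^ 2) / (4 * π) =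
        (riemannSiegelThetaDeriv s - Real.log (1 + s ^ 2) / 4) / π := by
      field_simp
    rw [e, abs_div, abs_of_pos Real.pi_pos]
    exact div_le_self (abs_nonneg _) (by linarith)
  refine hred.trans ?_
  by_cases hs : |s| ≤ 1
  · have h1 : ‖riemannSiegelThetaDeriv s‖ ≤ M₀ := hM₀ s (abs_le.1 hs)
    rw [Real.norm_eq_abs] at h1
    have h2 : 0 ≤ Real.log (1 + s ^ 2) := Real.log_nonneg (by nlinarith)
    have h3 : Real.log (1 + s ^ 2) ≤ Real.log 2 := by
      refine Real.log_le_log (by positivity) ?_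
      have : s ^ 2 ≤ 1 := by
        have := abs_le.1 hs
        nlinarith
      linarith
    have h4 := abs_le.1 h1
    rw [abs_le]; constructor <;> linarith
  · have hu1 : 1 ≤ |s| := le_of_lt (not_le.1 hs)
    set u : ℝ := |s| with hu
    have hupos : 0 < u := by linarith
    have hθ : riemannSiegelThetaDeriv s = riemannSiegelThetaDeriv u := by
      rcases abs_choice s with h | h
      · rw [hu, h]
      · rw [hu, h, riemannSiegelThetaDeriv_neg_holds]
    have hL : Real.log (1 + s ^ 2) = Real.log (1 + u ^ 2) := by rw [hu, sq_abs]
    have h1 := abs_le.1 (abs_riemannSiegelThetaDeriv_sub_log_le hu1)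
    have h2 : 2 / u ≤ 2 := div_le_self (by norm_num) hu1
    have hE : Real.log (1 + u ^ 2) - 2 * Real.log u = Real.log ((1 + u ^ 2) / u ^ 2) := by
      rw [Real.log_div (by positivity) (by positivity), Real.log_pow]; push_cast; ring
    have hE0 : 0 ≤ Real.log (1 + u ^ 2) - 2 * Real.log u := by
      rw [hE]
      exact Real.log_nonneg (by rw [le_div_iff₀ (by positivity)]; nlinarith)
    have hE1 : Real.log (1 + u ^ 2) - 2 * Real.log u ≤ Real.log 2 := by
      rw [hE]
      exact Real.log_le_log (by positivity) (by rw [div_le_iff₀ (by positivity)]; nlinarith)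
    have hsplit : Real.log (u / (2 * π)) = Real.log u - Real.log (2 * π) :=
      Real.log_div (by positivity) (by positivity)
    rw [hθ, hL, abs_le]
    rw [hsplit] at h1
    constructor <;> linarith [h1.1, h1.2]

/-! ### The density at scale `A` -/

/-- **The density at scale `A`.** Given the kernel `K` (`C²`, `K, K', K'' = O(1/(1+t²))`, `∫ K = 1`),
a bounded continuous `b`, and the log-smoothing constant `M` of `K`: for `0 < A ≤ 1` the function
`ν(t) = ∫ K(u) ℓ(t − u/A) du + A ∫ K(A(t−s)) b(s) ds` is `C²` with
`|ν(t) − log(1/A)/2π − log(1+(At)²)/4π| ≤ M/4π + CBπ`, `|ν'|, |ν''| ≤ Cπ + CBπ`, and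
`ν(t) = ∫ K(u) (ℓ + b)(t − u/A) du`. [folklore] -/
theorem scale_density {K dK ddK : ℝ → ℝ} {C : ℝ}
    (hKd : ∀ t, HasDerivAt K (dK t) t) (hdKd : ∀ t, HasDerivAt dK (ddK t) t)
    (hddKc : Continuous ddK) (hKb : ∀ t, |K t| ≤ C / (1 + t ^ 2))
    (hdKb : ∀ t, |dK t| ≤ C / (1 + t ^ 2)) (hddKb : ∀ t, |ddK t| ≤ C / (1 + t ^ 2))
    (hK_one : ∫ u, K u = 1) {b : ℝ → ℝ} (hb : Continuous b) {B : ℝ} (hbB : ∀ s, |b s| ≤ B)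
    {M : ℝ} (hM : ∀ a v : ℝ, 0 < a → a ≤ 1 →
      Integrable (fun u => K u * (Real.log (a ^ 2 + (v - u) ^ 2) - Real.log (1 + v ^ 2))) ∧
      |∫ u, K u * (Real.log (a ^ 2 + (v - u) ^ 2) - Real.log (1 + v ^ 2))| ≤ M)
    {A : ℝ} (hA : 0 < A) (hA1 : A ≤ 1) :
    ∃ ν dν ddν : ℝ → ℝ,
      (∀ t, HasDerivAt ν (dν t) t) ∧ (∀ t, HasDerivAt dν (ddν t) t) ∧ Continuous ddν ∧
      (∀ t, |ν t - Real.log (1 / A) / (2 * π) - Real.log (1 + (A * t) ^ 2) / (4 * π)| ≤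
        M / (4 * π) + C * B * π) ∧
      (∀ t, |dν t| ≤ C * 1 * π + C * B * π) ∧ (∀ t, |ddν t| ≤ C * 1 * π + C * B * π) ∧
      (∀ t, ν t = ∫ u, K u * (Real.log (1 + (t - u / A) ^ 2) / (4 * π) + b (t - u / A))) := by
  have hK_cont : Continuous K := continuous_iff_continuousAt.2 fun t => (hKd t).continuousAt
  have hdK_cont : Continuous dK := continuous_iff_continuousAt.2 fun t => (hdKd t).continuousAt
  have hKi : Integrable K := FixedPoint.integrable_of_decay hK_cont hKb
  -- `ℓ` and its derivatives (kept as explicit lambdas)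
  obtain ⟨ℓ, hℓ⟩ : ∃ ℓ : ℝ → ℝ, ℓ = fun s => Real.log (1 + s ^ 2) / (4 * π) := ⟨_, rfl⟩
  obtain ⟨ℓ₁, hℓ₁⟩ : ∃ ℓ₁ : ℝ → ℝ, ℓ₁ = fun s => 2 * s / (1 + s ^ 2) / (4 * π) := ⟨_, rfl⟩
  obtain ⟨ℓ₂, hℓ₂⟩ : ∃ ℓ₂ : ℝ → ℝ,
    ℓ₂ = fun s => (2 * (1 + s ^ 2) - 2 * s * (2 * s)) / (1 + s ^ 2) ^ 2 / (4 * π) := ⟨_, rfl⟩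
  have hℓd : ∀ s, HasDerivAt ℓ (ℓ₁ s) s := fun s => by rw [hℓ, hℓ₁]; exact hasDerivAt_ell s
  have hℓ₁d : ∀ s, HasDerivAt ℓ₁ (ℓ₂ s) s := fun s => by rw [hℓ₁, hℓ₂]; exact hasDerivAt_ell₁ s
  have hℓ₁c : Continuous ℓ₁ := continuous_iff_continuousAt.2 fun s => (hℓ₁d s).continuousAt
  have hℓ₂c : Continuous ℓ₂ := by rw [hℓ₂]; exact continuous_ell₂
  have hℓ₁b : ∀ s, |ℓ₁ s| ≤ 1 := fun s => by rw [hℓ₁]; exact abs_ell₁_le s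
  have hℓ₂b : ∀ s, |ℓ₂ s| ≤ 1 := fun s => by rw [hℓ₂]; exact abs_ell₂_le s
  -- the density and its derivatives
  obtain ⟨ν, hν⟩ : ∃ ν : ℝ → ℝ,
    ν = fun t => (∫ u, K u * ℓ (t - u / A)) + A * ∫ s, K (A * (t - s)) * b s := ⟨_, rfl⟩
  obtain ⟨dν, hdν⟩ : ∃ dν : ℝ → ℝ,
    dν = fun t => (∫ u, K u * ℓ₁ (t - u / A)) + A * ∫ s, A * dK (A * (t - s)) * b s := ⟨_, rfl⟩
  obtain ⟨ddν, hddν⟩ : ∃ ddν : ℝ → ℝ, ddν = fun t =>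
    (∫ u, K u * ℓ₂ (t - u / A)) + A * ∫ s, A * (A * ddK (A * (t - s))) * b s := ⟨_, rfl⟩
  -- the closed form of the `ℓ`-part up to the log-smoothing error
  have hν₁ : ∀ t, Integrable (fun u => K u * ℓ (t - u / A)) ∧
      (∫ u, K u * ℓ (t - u / A)) = Real.log (1 / A) / (2 * π) +
        Real.log (1 + (A * t) ^ 2) / (4 * π) +
        (∫ u, K u * (Real.log (A ^ 2 + (A * t - u) ^ 2) - Real.log (1 + (A * t) ^ 2))) /
          (4 * π) := by
    intro t
    obtain ⟨hDi, -⟩ := hM A (A * t) hA hA1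
    have hpt : ∀ u, K u * ℓ (t - u / A) =
        K u * ((2 * Real.log (1 / A) + Real.log (1 + (A * t) ^ 2)) / (4 * π)) +
        K u * (Real.log (A ^ 2 + (A * t - u) ^ 2) - Real.log (1 + (A * t) ^ 2)) / (4 * π) := by
      intro u
      have h1 : 1 + (t - u / A) ^ 2 = (A ^ 2 + (A * t - u) ^ 2) / A ^ 2 := by
        field_simp
      have h2 : Real.log (1 + (t - u / A) ^ 2) =
          2 * Real.log (1 / A) + Real.log (A ^ 2 + (A * t - u) ^ 2) := by
        rw [h1, Real.log_div (by positivity) (by positivity), Real.log_pow, one_div, Real.log_inv]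
        push_cast; ring
      rw [hℓ]
      simp only [h2]
      ring
    have hi1 : Integrable (fun u => K u *
        ((2 * Real.log (1 / A) + Real.log (1 + (A * t) ^ 2)) / (4 * π))) := hKi.mul_const _
    have hi2 : Integrable (fun u => K u *
        (Real.log (A ^ 2 + (A * t - u) ^ 2) - Real.log (1 + (A * t) ^ 2)) / (4 * π)) :=
      hDi.div_const _
    have heq : (fun u => K u * ℓ (t - u / A)) = fun u =>
        K u * ((2 * Real.log (1 / A) + Real.log (1 + (A * t) ^ 2)) / (4 * π)) +
        K u * (Real.log (A ^ 2 + (A * t - u) ^ 2) - Real.log (1 + (A * t) ^ 2)) / (4 * π) :=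
      funext hpt
    refine ⟨by rw [heq]; exact hi1.add hi2, ?_⟩
    rw [heq, integral_add hi1 hi2, integral_mul_const, integral_div, hK_one]
    ring
  -- dilated kernels keep the `C/(1+x²)` bound (`A ≤ 1`)
  have hshrink : ∀ f : ℝ → ℝ, (∀ x, |f x| ≤ C / (1 + x ^ 2)) →
      ∀ x, |A * f x| ≤ C / (1 + x ^ 2) := fun f hf x => by
    rw [abs_mul, abs_of_pos hA]
    calc A * |f x| ≤ 1 * |f x| := mul_le_mul_of_nonneg_right hA1 (abs_nonneg _)
      _ ≤ C / (1 + x ^ 2) := by rw [one_mul]; exact hf x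
  have hAdKb : ∀ x, |A * dK x| ≤ C / (1 + x ^ 2) := hshrink dK hdKb
  have hAddKb : ∀ x, |A * ddK x| ≤ C / (1 + x ^ 2) := hshrink ddK hddKb
  have hAAddKb : ∀ x, |A * (A * ddK x)| ≤ C / (1 + x ^ 2) := hshrink _ hAddKb
  have hAdKd : ∀ x, HasDerivAt (fun x => A * dK x) (A * ddK x) x := fun x => (hdKd x).const_mul A
  have hint₁ : ∀ f : ℝ → ℝ, Continuous f → (∀ x, |f x| ≤ 1) →
      ∀ t, Integrable (fun u => K u * f (t - u / A)) := fun f hf hfb t =>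
    hKi.mul_bdd (hf.comp (continuous_const.sub (continuous_id.div_const A))).aestronglyMeasurable
      (Eventually.of_forall fun u => by rw [Real.norm_eq_abs]; exact hfb _)
  refine ⟨ν, dν, ddν, fun t => ?_, fun t => ?_, ?_, fun t => ?_, fun t => ?_, fun t => ?_, fun t => ?_⟩
  · rw [hν, hdν]
    exact (hasDerivAt_integral_shift hKi hℓd hℓ₁c hℓ₁b A (fun t => (hν₁ t).1) t).add
      ((hasDerivAt_integral_kernel hKd hdK_cont hKb hdKb hb hbB hA t).const_mul A)
  · rw [hdν, hddν]
    exact (hasDerivAt_integral_shift hKi hℓ₁d hℓ₂c hℓ₂b A (hint₁ ℓ₁ hℓ₁c hℓ₁b) t).add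
      ((hasDerivAt_integral_kernel hAdKd (continuous_const.mul hddKc) hAdKb hAddKb
        hb hbB hA t).const_mul A)
  · rw [hddν]
    have h1 : Continuous fun t => ∫ u, K u * ℓ₂ (t - u / A) :=
      continuous_integral_shift hKi hℓ₂c hℓ₂b A
    have h2 : Continuous fun t => A * ∫ s, A * (A * ddK (A * (t - s))) * b s := by
      have e : (fun t => A * ∫ s, A * (A * ddK (A * (t - s))) * b s) =
          fun t => ∫ u, (A * (A * ddK u)) * b (t - u / A) :=
        funext fun t => dilate_subst (fun x => A * (A * ddK x)) b hA t
      rw [e]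
      exact continuous_integral_shift
        ((FixedPoint.integrable_of_decay hddKc hddKb).const_mul (A * A) |>.congr
          (Eventually.of_forall fun u => by ring)) hb hbB A
    exact h1.add h2
  · obtain ⟨-, hI⟩ := hM A (A * t) hA hA1
    have h2 := abs_dilate_integral_le hKb hbB hA t
    have h3 := (hν₁ t).2
    have e : ν t - Real.log (1 / A) / (2 * π) - Real.log (1 + (A * t) ^ 2) / (4 * π) =
        (∫ u, K u * (Real.log (A ^ 2 + (A * t - u) ^ 2) - Real.log (1 + (A * t) ^ 2))) /
          (4 * π) + A * ∫ s, K (A * (t - s)) * b s := by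
      rw [hν]; simp only [h3]; ring
    rw [e]
    refine (abs_add_le _ _).trans (add_le_add ?_ h2)
    rw [abs_div, abs_of_pos (by positivity : (0 : ℝ) < 4 * π)]
    exact div_le_div_of_nonneg_right hI (by positivity)
  · rw [hdν]
    exact (abs_add_le _ _).trans (add_le_add (abs_integral_mul_shift_le hKb hℓ₁b A t)
      (abs_dilate_integral_le hAdKb hbB hA t))
  · rw [hddν]
    exact (abs_add_le _ _).trans (add_le_add (abs_integral_mul_shift_le hKb hℓ₂b A t)
      (abs_dilate_integral_le hAAddKb hbB hA t))
  · have hib : Integrable fun u => K u * b (t - u / A) :=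
      hKi.mul_bdd (hb.comp (continuous_const.sub (continuous_id.div_const A))).aestronglyMeasurable
        (Eventually.of_forall fun u => by rw [Real.norm_eq_abs]; exact hbB _)
    rw [hν]
    simp only []
    rw [dilate_subst K b hA t, ← integral_add (hν₁ t).1 hib]
    congr 1 with u
    rw [hℓ]; ring

/-! ### Landing anchor -/

/-- **Landing anchor of this auxiliary file** (registered sub-goal `stub_density_aux3` of item
stmt-RiemannHypothesis-0187, stub `stub_density`): binder-free restatement of `scale_density`.
[folklore] -/
theorem stub_density_aux3 : ∀ (K dK ddK : ℝ → ℝ) (C : ℝ), (∀ t, HasDerivAt K (dK t) t) →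
    (∀ t, HasDerivAt dK (ddK t) t) → Continuous ddK → (∀ t, |K t| ≤ C / (1 + t ^ 2)) →
    (∀ t, |dK t| ≤ C / (1 + t ^ 2)) → (∀ t, |ddK t| ≤ C / (1 + t ^ 2)) → (∫ u, K u) = 1 →
    ∀ (b : ℝ → ℝ) (B : ℝ), Continuous b → (∀ s, |b s| ≤ B) → ∀ (M : ℝ),
    (∀ a v : ℝ, 0 < a → a ≤ 1 →
      Integrable (fun u => K u * (Real.log (a ^ 2 + (v - u) ^ 2) - Real.log (1 + v ^ 2))) ∧
      |∫ u, K u * (Real.log (a ^ 2 + (v - u) ^ 2) - Real.log (1 + v ^ 2))| ≤ M) →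
    ∀ (A : ℝ), 0 < A → A ≤ 1 →
    ∃ ν dν ddν : ℝ → ℝ,
      (∀ t, HasDerivAt ν (dν t) t) ∧ (∀ t, HasDerivAt dν (ddν t) t) ∧ Continuous ddν ∧
      (∀ t, |ν t - Real.log (1 / A) / (2 * π) - Real.log (1 + (A * t) ^ 2) / (4 * π)| ≤
        M / (4 * π) + C * B * π) ∧
      (∀ t, |dν t| ≤ C * 1 * π + C * B * π) ∧ (∀ t, |ddν t| ≤ C * 1 * π + C * B * π) ∧
      (∀ t, ν t = ∫ u, K u * (Real.log (1 + (t - u / A) ^ 2) / (4 * π) + b (t - u / A))) :=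
  fun _ _ _ _ hKd hdKd hddKc hKb hdKb hddKb hK1 _ _ hb hbB _ hM _ hA hA1 =>
    scale_density hKd hdKd hddKc hKb hdKb hddKb hK1 hb hbB hM hA hA1

end Density

end Summit.RiemannHypothesis.RiemannHypothesis.Theorems.SpectralThesis.Sketch

end
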